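import Mathlib
import Literature.NumberTheory.LFunctions.Zhang2022.SkeletonPartThree
import HarnessLib

/-!
# Zhang (2022) §8e, typed statements: the head of §8 «Evaluation of Ξ₁₁» — Ξ₁, (8.2)–(8.8), the
# coefficients ϰⱼ, the expansion of S_j(𝐚₁₁,𝐚₂₁), and β₄ = β₁, β₅ = β₂

Cell `siegel-zhang`, D-0069 statement-typing campaign, layer L2, slice **row 7a (L2-t2)** of
`plan/L2/ASSIGNMENTS.md` v3.1: Y. Zhang, *Discrete mean estimates and the Landau–Siegel zero*,
arXiv:2211.02515v1 (2022) [Zhang2022LandauSiegel], **§8, tex L2266–L2334 of the arXiv source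
`lsz3__2_.tex`, PDF pp. 44–45** — an UNREFEREED manuscript under adjudication. **Every
`def … : Prop` below is a CLAIM OF THE MANUSCRIPT, STATED NOT ASSERTED; typed ≠ discharged.
WHAT THIS IS NOT: any claim about Theorems 1–2 of the source or about Landau–Siegel zeros.**

DAG nodes typed here (ids of `plan/DAG.tsv`; the first token of every docstring is the node id):

| node | tex | p. | decl here | kind |
|---|---|---|---|---|
| `Z22:§8.u018` `Ξ₁ = ΣΣ𝔠*\|H₁+Z(ρ,ψχ)H̄₂\|²ω` | L2267 | 44 | `xi1_def` (object banked: `Skeleton.xi1`) | object |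
| prose L2270 "`\|Z(s,ψχ)\| = 1` if `σ = 1/2`" | L2270 | 44 | `Step8u018Z` + `step8u018Z_holds` (PROVED, all `t`; tree had `Im s > 0`: `Skeleton.norm_Zpc_eq_one`) | CLAIM |
| `Z22:(8.2)` | L2271 | 44 | `Eq82`; EDGE `eq82_of : Prop22i → Lemma23 → Eq82` PROVED here from the banked `Skeleton.xi1_eq_of` (node discharged p403315) | CLAIM + edge |
| `Z22:(8.3)`–`(8.5)` `Ξ₁₁, Ξ₁₂, Ξ₁₃` | L2275–2281 | 44 | `xi11_def`, `xi12_def`, `xi13_def` (`Skeleton.xi11/xi12/xi13`) | object |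
| `Z22:(8.6)` `H₁ⱼ = Σϰⱼ(n)ψχ(n)n⁻ˢ` | L2286 | 44 | `H11_eq`, `H12_eq`, `H13_eq` (`Skeleton.H11/H12/H13`, which the skeleton DEFINES by (8.6); (2.23)–(2.25) inline the same coefficients) | object |
| `Z22:§8.u019`–`u021` `ϰ₁, ϰ₂, ϰ₃` | L2290–2304 | 44 | `vk1_def`, `vk2_def`, `vk3_def` (`Skeleton.vk1/vk2/vk3`) | object |
| `Z22:(8.7)` | L2315 | 44 | none new: banked `Skeleton.Eq87 c'`, EDGE `Skeleton.eq87_of` (discharged p404629) | CLAIM (banked) |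
| `Z22:(8.8)` `a₁₁, a₂₁` | L2319 | 44 | `a11_def`, `a21_def` (`Skeleton.a11/a21`) | object |
| `Z22:§8.u022` `S_j(𝐚₁₁,𝐚₂₁) = …` | L2323 | 45 | `Step8u022` + `step8u022_holds` (PROVED) | CLAIM |
| `Z22:§8.u023` `β₄ = β₁, β₅ = β₂` | L2330 | 45 | `betaJ_four`, `betaJ_five` (`Skeleton.betaJ` reads `j` mod 3) | object |
| `Z22:§8.u024` `{β_j,β_{j+1},β_{j+2}} = {β₁,β₂,β₃}` | L2334 | 45 | `Step8u024` + `step8u024_holds` (PROVED, definitional) | CLAIM |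

Conventions (skel/INTERFACE.md §3, binding): as in `Section7aStatements` — `Skeleton.ForAllLarge`,
Assumption (A) as an antecedent of the `χ`-dependent claims, "`= … + o(𝔓)`" ↦ `∀ ε > 0, …`, norms
not real parts, `c′` of (2.13) explicit. NOTE on the banked typing of the discrete means: the
skeleton types `Ξ₁, Ξ₁₁, Ξ₁₂` (`Skeleton.xi1/xi11/xi12`) as REAL numbers with `Re 𝔠*(ρ,ψ)` and
`Re ω(ρ)` in place of `𝔠*(ρ,ψ)`, `ω(ρ)` — both are real at the zeros `ρ ∈ 𝔷(ψ)`, `ψ ∈ Ψ₁`, by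
Lemma 2.3 / Prop. 2.2 (i) / (2.15) (the hypotheses of `Skeleton.xi1_eq_of`); `Ξ₁₃` (`Skeleton.xi13`)
is complex. This file cites those objects; it does not re-type them.

Statement-only file except for the kernel-checked edges/discharges `eq82_of`, `step8u024_holds`,
`step8u018Z_holds` (`|Z(½+it,ψχ)| = 1` for every real `t`, via `norm_Zfac_half_eq_one_all`) and
`step8u022_holds` (the `S_j(𝐚₁₁,𝐚₂₁)` expansion) (no `sorry`, no `axiom`, no instances, no
notation). Nothing here bears on the cell's verdict of record (`Skeleton.Margin232`, `Ineq824`).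

## References

* Y. Zhang, arXiv:2211.02515v1 (2022), §8 pp. 44–45, (8.2)–(8.8); §2 (2.23)–(2.27) p. 10.
  [cite: Zhang2022LandauSiegel, §8 pp. 44–45]
-/

noncomputable section

open Complex Real ComplexConjugate

namespace Literature.NumberTheory.LFunctions.Zhang2022.Section8eStatements

/-! ## `Ξ₁` and (8.2)–(8.5) (p. 44) -/

section XiOne

variable (c' : ℝ) {D : ℕ} [NeZero D] (χ : DirichletCharacter ℂ D)

/-- `Z22:§8.u018` OBJECT (banked as `Skeleton.xi1`; p. 44 "Recall that `H₁(s,ψ)` and `H₂(s,ψ)` are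
given by (2.27). Write"): "`Ξ₁ = Σ_{ψ∈Ψ₁} Σ_{ρ∈𝔷(ψ)} 𝔠*(ρ,ψ)|H₁(ρ,ψ) + Z(ρ,ψχ)conj H₂(s,ψ)|²ω(ρ)`"
(printed `H₂(s,ψ)` inside, read `H₂(ρ,ψ)`; the index set `Σ_{ψ∈Ψ₁}Σ_{ρ∈𝔷(ψ)}` is `Skeleton.idx χ`;
real typing with `Re 𝔠*`, `Re ω`, see the module docstring). [cite: Zhang2022LandauSiegel, §8 p.44, tex L2267] -/
theorem xi1_def :
    Skeleton.xi1 c' χ =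
      ∑ i ∈ Skeleton.idx χ, (Skeleton.cstar c' D i.1 i.2).re *
        ‖Skeleton.H1 χ i.1 i.2 + Skeleton.Zpc χ i.1 i.2 * conj (Skeleton.H2 χ i.1 i.2)‖ ^ 2 *
          (Skeleton.omegaW D i.2).re := rfl

omit c' in
/-- CLAIM (prose, p. 44 tex L2270): "Since `|Z(s,ψχ)| = 1` if `σ = 1/2`" (`Z(s,ψχ)` = `Skeleton.Zpc`,
the root-number factor of (2.2) for the primitive character `ψχ (mod Dp)`). PROVED in the tree for
`Im s > 0`: `Skeleton.norm_Zpc_eq_one` (with `Skeleton.psiChiPrimitive_holds`).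
[cite: Zhang2022LandauSiegel, §8 p.44, tex L2270] -/
def Step8u018Z : Prop :=
  ∀ (D : ℕ) [NeZero D] (χ : DirichletCharacter ℂ D) (x : Skeleton.Chr D) (s : ℂ),
    3 ≤ D → χ.IsPrimitive → s.re = 1 / 2 → ‖Skeleton.Zpc χ x s‖ = 1

/-- `Z22:(8.2)` CLAIM (p. 44): "`Ξ₁ = Ξ₁₁ + Ξ₁₂ + 2Re{Ξ₁₃}`" (under (A), for `D` large). The node is
DISCHARGED in the tree as the edge `Skeleton.xi1_eq_of` (p403315; from Prop. 2.2 (i), Lemma 2.3 and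
the primitivity of `ψχ`); `eq82_of` below packages it in the `ForAllLarge` form.
[cite: Zhang2022LandauSiegel, §8 (8.2) p.44, tex L2271] -/
def Eq82 : Prop :=
  Skeleton.ForAllLarge fun D _ χ => Skeleton.AssumptionA D χ →
    Skeleton.xi1 c' χ = Skeleton.xi11 c' χ + Skeleton.xi12 c' χ + 2 * (Skeleton.xi13 c' χ).re

omit χ in
/-- EDGE for `Z22:(8.2)`: (8.2) FOLLOWS from Prop. 2.2 (i) (`Skeleton.Prop22i`) and Lemma 2.3
(`Skeleton.Lemma23 c'`), by the banked `Skeleton.xi1_eq_of` and `Skeleton.psiChiPrimitive_holds`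
(kernel-checked; 0 new facts). [cite: Zhang2022LandauSiegel, §8 (8.2) p.44, tex L2271] -/
theorem eq82_of (h22 : Skeleton.Prop22i) (h23 : Skeleton.Lemma23 c') : Eq82 c' := by
  obtain ⟨D₀, h⟩ := h22.and h23
  refine ⟨max D₀ 3, fun D _ χ hD hq hp _ => ?_⟩
  have hD3 : 3 ≤ D := le_trans (le_max_right _ _) hD
  obtain ⟨h22', h23'⟩ := h D χ (le_trans (le_max_left _ _) hD) hq hp
  exact Skeleton.xi1_eq_of χ hD3 h23' h22' fun x => Skeleton.psiChiPrimitive_holds D χ x hD3 hp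

omit [NeZero D] in
/-- `Z22:(8.3)` OBJECT (banked as `Skeleton.xi11`): "`Ξ₁₁ = Σ_{ψ∈Ψ₁}Σ_{ρ∈𝔷(ψ)} 𝔠*(ρ,ψ)|H₁(ρ,ψ)|²ω(ρ)`".
[cite: Zhang2022LandauSiegel, §8 (8.3) p.44, tex L2275] -/
theorem xi11_def :
    Skeleton.xi11 c' χ =
      ∑ i ∈ Skeleton.idx χ, (Skeleton.cstar c' D i.1 i.2).re * ‖Skeleton.H1 χ i.1 i.2‖ ^ 2 *
        (Skeleton.omegaW D i.2).re := rfl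

omit [NeZero D] in
/-- `Z22:(8.4)` OBJECT (banked as `Skeleton.xi12`): "`Ξ₁₂ = Σ_{ψ∈Ψ₁}Σ_{ρ∈𝔷(ψ)} 𝔠*(ρ,ψ)|H₂(ρ,ψ)|²ω(ρ)`".
[cite: Zhang2022LandauSiegel, §8 (8.4) p.44, tex L2278] -/
theorem xi12_def :
    Skeleton.xi12 c' χ =
      ∑ i ∈ Skeleton.idx χ, (Skeleton.cstar c' D i.1 i.2).re * ‖Skeleton.H2 χ i.1 i.2‖ ^ 2 *
        (Skeleton.omegaW D i.2).re := rfl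

/-- `Z22:(8.5)` OBJECT (banked as `Skeleton.xi13`, complex):
"`Ξ₁₃ = Σ_{ψ∈Ψ₁}Σ_{ρ∈𝔷(ψ)} 𝔠*(ρ,ψ)Z(ρ,ψχ)⁻¹H₁(ρ,ψ)H₂(ρ,ψ)ω(ρ)`".
[cite: Zhang2022LandauSiegel, §8 (8.5) p.44, tex L2281] -/
theorem xi13_def :
    Skeleton.xi13 c' χ =
      ∑ i ∈ Skeleton.idx χ, Skeleton.cstar c' D i.1 i.2 * (Skeleton.Zpc χ i.1 i.2)⁻¹ *
        (Skeleton.H1 χ i.1 i.2 * Skeleton.H2 χ i.1 i.2) * Skeleton.omegaW D i.2 := rfl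

omit c' χ in
/-- `|Z(½+it,θ)| = 1` for a primitive `θ` and EVERY real `t` (the tree's
`GammaFactor.norm_Zfac_half_eq_one` has `t > 0`): directly from the printed form (2.2) of `Z`, since
`(1−s)/2 = conj(s/2)` (even case), `(2−s)/2 = conj((1+s)/2)` (odd case) on `σ = 1/2`, `Γ(conj z) =
conj Γ(z)`, `|τ(θ)| = √k`, `|π^{it}| = 1`, `|k^{−s}| = k^{−1/2}`. [cite: Zhang2022LandauSiegel, §8 p.44, tex L2270] -/
theorem norm_Zfac_half_eq_one_all {k : ℕ} [NeZero k] {θ : DirichletCharacter ℂ k}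
    (hθ : θ.IsPrimitive) (t : ℝ) : ‖GammaFactor.Zfac θ (1 / 2 + t * I)‖ = 1 := by
  have hk0 : (0 : ℝ) < k := Nat.cast_pos.mpr (Nat.pos_of_ne_zero (NeZero.ne k))
  have h2 : ‖GammaFactor.tau θ‖ = Real.sqrt k := by
    rw [← Real.sqrt_sq (norm_nonneg (GammaFactor.tau θ)), GammaFactor.tau,
      Literature.NumberTheory.Sieve.LargeSieve.norm_gaussSum_sq hθ]
  have hπ : ‖(π : ℂ) ^ ((1 : ℂ) / 2 + t * I - 1 / 2)‖ = 1 := by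
    rw [Complex.norm_cpow_eq_rpow_re_of_pos Real.pi_pos]
    simp
  have h3 : ‖(k : ℂ) ^ (-((1 : ℂ) / 2 + t * I))‖ = (k : ℝ) ^ (-(1 / 2 : ℝ)) := by
    rw [Complex.norm_natCast_cpow_of_pos (Nat.pos_of_ne_zero (NeZero.ne k))]
    congr 1
    simp
  have hG : ∀ z : ℂ, 0 < z.re →
      ‖Complex.Gamma ((starRingEnd ℂ) z)‖ * ‖(Complex.Gamma z)⁻¹‖ = 1 := by
    intro z hz
    rw [Complex.Gamma_conj, Complex.norm_conj, norm_inv,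
      mul_inv_cancel₀ (norm_ne_zero_iff.mpr (Complex.Gamma_ne_zero_of_re_pos hz))]
  have he : (1 - ((1 : ℂ) / 2 + t * I)) / 2 = (starRingEnd ℂ) (((1 : ℂ) / 2 + t * I) / 2) := by
    simp only [map_div₀, map_add, map_mul, map_one, map_ofNat, Complex.conj_ofReal, Complex.conj_I]
    ring
  have ho : (2 - ((1 : ℂ) / 2 + t * I)) / 2 = (starRingEnd ℂ) ((1 + ((1 : ℂ) / 2 + t * I)) / 2) := by
    simp only [map_div₀, map_add, map_mul, map_one, map_ofNat, Complex.conj_ofReal, Complex.conj_I]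
    ring
  have hsq : Real.sqrt k * (k : ℝ) ^ (-(1 / 2 : ℝ)) = 1 := by
    rw [Real.sqrt_eq_rpow, ← Real.rpow_add hk0]
    norm_num
  unfold GammaFactor.Zfac
  split_ifs with hev
  · rw [norm_mul, norm_mul, norm_mul, norm_mul, h2, hπ, h3, he, mul_one, mul_assoc, hG _ (by simp),
      mul_one, hsq]
  · rw [norm_mul, norm_mul, norm_mul, norm_mul, norm_mul, norm_neg, Complex.norm_I, one_mul, h2, hπ,
      h3, ho, mul_one, mul_assoc, hG _ (by norm_num), mul_one, hsq]

omit c' χ in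
/-- The prose claim "`|Z(s,ψχ)| = 1` if `σ = 1/2`" (`Step8u018Z`) HOLDS (for all `t`; kernel-checked,
0 new facts), by `norm_Zfac_half_eq_one_all` and `Skeleton.psiChiPrimitive_holds`.
[cite: Zhang2022LandauSiegel, §8 p.44, tex L2270] -/
theorem step8u018Z_holds : Step8u018Z := by
  intro D _ χ x s hD hp hre
  have hs : s = 1 / 2 + (s.im : ℂ) * I := Complex.ext (by simp [hre]) (by simp)
  rw [Skeleton.Zpc, hs]
  exact norm_Zfac_half_eq_one_all (Skeleton.psiChiPrimitive_holds D χ x hD hp) s.im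

/-- `Step8u018Z` — `_holds` alias of `step8u018Z_holds` above under the fact's exact name (appended
2026-08-28, D-0026 bookkeeping: the proof term is the existing theorem of this file; no statement,
definition or attribute is edited; no new named fact; the ledger's debt table listed the fact
unproved). [cite: Zhang2022LandauSiegel, §8 p.44, tex L2270] -/
theorem _root_.Literature.NumberTheory.LFunctions.Zhang2022.Section8eStatements.Step8u018Z_holds :
    Step8u018Z :=
  _root_.Literature.NumberTheory.LFunctions.Zhang2022.Section8eStatements.step8u018Z_holds

end XiOne

/-! ## (8.6) and the coefficients `ϰⱼ` (p. 44) -/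

section Coefficients

variable {D : ℕ} (χ : DirichletCharacter ℂ D) (x : Skeleton.Chr D)

/-- `Z22:(8.6)` OBJECT (banked as `Skeleton.H11`; p. 44 "We may write"): "`H₁₁(s,ψ) = Σ_n ϰ₁(n)ψχ(n)n^{−s}`"
(a finite sum, `ϰ₁(n) = 0` for `n ≥ P₁`; `ψχ(n)` = `Skeleton.pc χ x n`; the skeleton DEFINES
`H₁₁` of (2.23) by this display). [cite: Zhang2022LandauSiegel, §8 (8.6) p.44, tex L2286] -/
theorem H11_eq (s : ℂ) :
    Skeleton.H11 χ x s =
      ∑ n ∈ Finset.Ico 1 ⌈Skeleton.P1 D⌉₊, Skeleton.vk1 D n * Skeleton.pc χ x n * (n : ℂ) ^ (-s) :=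
  rfl

/-- `Z22:(8.6)` OBJECT (banked as `Skeleton.H12`): "`H₁₂(s,ψ) = Σ_n ϰ₂(n)ψχ(n)n^{−s}`" ((2.24)).
[cite: Zhang2022LandauSiegel, §8 (8.6) p.44, tex L2286] -/
theorem H12_eq (s : ℂ) :
    Skeleton.H12 χ x s =
      ∑ n ∈ Finset.Ico 1 ⌈Skeleton.P2 D⌉₊, Skeleton.vk2 D n * Skeleton.pc χ x n * (n : ℂ) ^ (-s) :=
  rfl

/-- `Z22:(8.6)` OBJECT (banked as `Skeleton.H13`): "`H₁₃(s,ψ) = Σ_n ϰ₃(n)ψχ(n)n^{−s}`" ((2.25)).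
[cite: Zhang2022LandauSiegel, §8 (8.6) p.44, tex L2286] -/
theorem H13_eq (s : ℂ) :
    Skeleton.H13 χ x s =
      ∑ n ∈ Finset.Ico 1 ⌈Skeleton.P3 D⌉₊, Skeleton.vk3 D n * Skeleton.pc χ x n * (n : ℂ) ^ (-s) :=
  rfl

omit χ x in
/-- `Z22:§8.u019` OBJECT (banked as `Skeleton.vk1`): "`ϰ₁(n) = (1 − log n/log P₁)(P₁/n)^{β₆}` if
`n < P₁`, `0` otherwise" (`P₁ = P^{0.504}` (2.21), `β₆ = 3iα/2` (2.22)).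
[cite: Zhang2022LandauSiegel, §8 (8.6) p.44, tex L2290] -/
theorem vk1_def (D n : ℕ) :
    Skeleton.vk1 D n =
      if (n : ℝ) < Skeleton.P1 D then
        (1 - Real.log n / Real.log (Skeleton.P1 D) : ℝ) *
          ((Skeleton.P1 D / n : ℝ) : ℂ) ^ Skeleton.beta6 D
      else 0 := rfl

omit χ x in
/-- `Z22:§8.u020` OBJECT (banked as `Skeleton.vk2`): "`ϰ₂(n) = (1 − log n/log P₂)(P₂/n)^{β₇}` if
`n < P₂`, `0` otherwise" (`P₂ = P^{0.5}T⁻¹⁰`, `β₇ = 5iα/2`). [cite: Zhang2022LandauSiegel, §8 (8.6) p.44, tex L2297] -/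
theorem vk2_def (D n : ℕ) :
    Skeleton.vk2 D n =
      if (n : ℝ) < Skeleton.P2 D then
        (1 - Real.log n / Real.log (Skeleton.P2 D) : ℝ) *
          ((Skeleton.P2 D / n : ℝ) : ℂ) ^ Skeleton.beta7 D
      else 0 := rfl

omit χ x in
/-- `Z22:§8.u021` OBJECT (banked as `Skeleton.vk3`): "`ϰ₃(n) = (1 − log n/log P₃)(P₃/n)^{β₆}` if
`n < P₃`, `0` otherwise" (`P₃ = P^{0.498}`). [cite: Zhang2022LandauSiegel, §8 (8.6) p.44, tex L2304] -/
theorem vk3_def (D n : ℕ) :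
    Skeleton.vk3 D n =
      if (n : ℝ) < Skeleton.P3 D then
        (1 - Real.log n / Real.log (Skeleton.P3 D) : ℝ) *
          ((Skeleton.P3 D / n : ℝ) : ℂ) ^ Skeleton.beta6 D
      else 0 := rfl

end Coefficients

/-! ## (8.7)–(8.8) and the expansion of `S_j(𝐚₁₁,𝐚₂₁)` (pp. 44–45) -/

section Sequences

variable (c' : ℝ) {D : ℕ} (χ : DirichletCharacter ℂ D)

omit c' in
/-- `Z22:(8.8)` OBJECT (banked as `Skeleton.a11`; (8.7) itself, "By Lemma 8.1,
`Ξ₁₁ = 2Re{Θ₁(𝐚₁₁,𝐚₂₁)} + o(𝔓)`", is the banked CLAIM `Skeleton.Eq87 c'` with the PROVED edge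
`Skeleton.eq87_of : Prop22i → Lemma23 → Lemma81 → Eq87`): "`a₁₁(n) = χ(n)(ϰ₁(n) + ι₂ϰ₂(n))`"
(`ι₂` of (2.26) = `iota2`). [cite: Zhang2022LandauSiegel, §8 (8.8) p.44, tex L2319] -/
theorem a11_def (n : ℕ) :
    Skeleton.a11 χ n = χ (n : ZMod D) * (Skeleton.vk1 D n + iota2 * Skeleton.vk2 D n) := rfl

omit c' in
/-- `Z22:(8.8)` OBJECT (banked as `Skeleton.a21`): "`a₂₁(n) = conj a₁₁(n)`".
[cite: Zhang2022LandauSiegel, §8 (8.8) p.44, tex L2319] -/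
theorem a21_def (n : ℕ) : Skeleton.a21 χ n = conj (Skeleton.a11 χ n) := rfl

/-- `Z22:§8.u022` CLAIM (p. 45, "By Proposition 7.1, our goal is reduced to evaluating the sum"):
"`S_j(𝐚₁₁,𝐚₂₁) = Σ_d Σ_r |χ(d)||μχ(r)|λ₀ⱼ(dr)/(drφ(r)) (Σ_m χ(m)(ϰ₁(drm)+ι₂ϰ₂(drm))/m^{1−β_j})
× (Σ_n χ(n)(ϰ̄₁(drn)+ῑ₂ϰ̄₂(drn))ξ₀ⱼ(n;d,r)/n)`" — the substitution of (8.8) into the banked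
`Skeleton.Sj` (same finite truncations `Finset.Ico 1 ⌈PT⁻²⌉`), for the real character `χ`.
[cite: Zhang2022LandauSiegel, §8 p.45, tex L2323] -/
def Step8u022 : Prop :=
  ∀ (D : ℕ) [NeZero D] (χ : DirichletCharacter ℂ D), χ.IsQuadratic → ∀ j : ℕ,
    Skeleton.Sj c' D j (Skeleton.a11 χ) (Skeleton.a21 χ) =
      ∑ d ∈ Finset.Ico 1 (Skeleton.Nsupp D), ∑ r ∈ Finset.Ico 1 (Skeleton.Nsupp D),
        (‖χ (d : ZMod D)‖ : ℂ) * (‖(ArithmeticFunction.moebius r : ℂ) * χ (r : ZMod D)‖ : ℂ) *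
              Skeleton.lamZero c' D j (d * r) / ((d * r : ℕ) * (Nat.totient r : ℂ)) *
          (∑ m ∈ Finset.Ico 1 (Skeleton.Nsupp D),
              χ (m : ZMod D) * (Skeleton.vk1 D (d * r * m) + iota2 * Skeleton.vk2 D (d * r * m)) /
                (m : ℂ) ^ (1 - Skeleton.betaJ c' D j)) *
          (∑ n ∈ Finset.Ico 1 (Skeleton.Nsupp D),
              χ (n : ZMod D) * (conj (Skeleton.vk1 D (d * r * n)) +
                  conj iota2 * conj (Skeleton.vk2 D (d * r * n))) *
                Skeleton.xiZero c' D j n d r / (n : ℂ))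

/-- `Z22:§8.u022` HOLDS: the expansion of `S_j(𝐚₁₁,𝐚₂₁)` is the substitution of (8.8) into the
banked `Skeleton.Sj`, using `χ(drm) = χ(d)χ(r)χ(m)`, `conj χ = χ` and `χ² = |χ|` for the real character
`χ`, and `|μ(r)|χ(r)² = |μχ(r)|` (kernel-checked; 0 new facts). [cite: Zhang2022LandauSiegel, §8 p.45, tex L2323] -/
theorem step8u022_holds : Step8u022 c' := by
  intro D _ χ hq j
  unfold Skeleton.Sj
  refine Finset.sum_congr rfl fun d _ => Finset.sum_congr rfl fun r _ => ?_
  have hχ : ∀ a : ZMod D, conj (χ a) = χ a ∧ χ a * χ a = (‖χ a‖ : ℂ) := by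
    intro a
    rcases hq a with h | h | h <;> simp [h]
  have h1 : ∑ m ∈ Finset.Ico 1 (Skeleton.Nsupp D),
        Skeleton.a11 χ (d * r * m) / (m : ℂ) ^ (1 - Skeleton.betaJ c' D j) =
      χ (d : ZMod D) * χ (r : ZMod D) *
        ∑ m ∈ Finset.Ico 1 (Skeleton.Nsupp D),
          χ (m : ZMod D) * (Skeleton.vk1 D (d * r * m) + iota2 * Skeleton.vk2 D (d * r * m)) /
            (m : ℂ) ^ (1 - Skeleton.betaJ c' D j) := by
    rw [Finset.mul_sum]
    refine Finset.sum_congr rfl fun m _ => ?_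
    simp only [Skeleton.a11, Nat.cast_mul, map_mul]
    ring
  have h2 : ∑ n ∈ Finset.Ico 1 (Skeleton.Nsupp D),
        Skeleton.a21 χ (d * r * n) * Skeleton.xiZero c' D j n d r / (n : ℂ) =
      χ (d : ZMod D) * χ (r : ZMod D) *
        ∑ n ∈ Finset.Ico 1 (Skeleton.Nsupp D),
          χ (n : ZMod D) * (conj (Skeleton.vk1 D (d * r * n)) +
              conj iota2 * conj (Skeleton.vk2 D (d * r * n))) *
            Skeleton.xiZero c' D j n d r / (n : ℂ) := by
    rw [Finset.mul_sum]
    refine Finset.sum_congr rfl fun n _ => ?_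
    simp only [Skeleton.a21, Skeleton.a11, Nat.cast_mul, map_mul, map_add, (hχ _).1]
    ring
  have key : ((ArithmeticFunction.moebius r).natAbs : ℂ) * (χ (d : ZMod D) * χ (d : ZMod D)) *
        (χ (r : ZMod D) * χ (r : ZMod D)) =
      (‖χ (d : ZMod D)‖ : ℂ) * (‖(ArithmeticFunction.moebius r : ℂ) * χ (r : ZMod D)‖ : ℂ) := by
    rw [(hχ _).2, (hχ _).2, norm_mul]
    rcases ArithmeticFunction.moebius_eq_or r with h | h | h <;> simp [h]
  rw [h1, h2]
  calc ((ArithmeticFunction.moebius r).natAbs : ℂ) * Skeleton.lamZero c' D j (d * r) /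
          ((d * r : ℕ) * (Nat.totient r : ℂ)) *
        (χ (d : ZMod D) * χ (r : ZMod D) *
          ∑ m ∈ Finset.Ico 1 (Skeleton.Nsupp D),
            χ (m : ZMod D) * (Skeleton.vk1 D (d * r * m) + iota2 * Skeleton.vk2 D (d * r * m)) /
              (m : ℂ) ^ (1 - Skeleton.betaJ c' D j)) *
        (χ (d : ZMod D) * χ (r : ZMod D) *
          ∑ n ∈ Finset.Ico 1 (Skeleton.Nsupp D),
            χ (n : ZMod D) * (conj (Skeleton.vk1 D (d * r * n)) +
                conj iota2 * conj (Skeleton.vk2 D (d * r * n))) *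
              Skeleton.xiZero c' D j n d r / (n : ℂ))
      = ((ArithmeticFunction.moebius r).natAbs : ℂ) * (χ (d : ZMod D) * χ (d : ZMod D)) *
            (χ (r : ZMod D) * χ (r : ZMod D)) *
          Skeleton.lamZero c' D j (d * r) / ((d * r : ℕ) * (Nat.totient r : ℂ)) *
          (∑ m ∈ Finset.Ico 1 (Skeleton.Nsupp D),
            χ (m : ZMod D) * (Skeleton.vk1 D (d * r * m) + iota2 * Skeleton.vk2 D (d * r * m)) /
              (m : ℂ) ^ (1 - Skeleton.betaJ c' D j)) *
          (∑ n ∈ Finset.Ico 1 (Skeleton.Nsupp D),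
            χ (n : ZMod D) * (conj (Skeleton.vk1 D (d * r * n)) +
                conj iota2 * conj (Skeleton.vk2 D (d * r * n))) *
              Skeleton.xiZero c' D j n d r / (n : ℂ)) := by ring
    _ = _ := by rw [key]

/-- `Step8u022` — `_holds` alias of `step8u022_holds` above under the fact's exact name (appended
2026-08-28, D-0026 bookkeeping: the proof term is the existing theorem of this file; no statement,
definition or attribute is edited; no new named fact; the ledger's debt table listed the fact
unproved). [cite: Zhang2022LandauSiegel, §8 p.45, tex L2323] -/
theorem _root_.Literature.NumberTheory.LFunctions.Zhang2022.Section8eStatements.Step8u022_holds :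
    Step8u022 c' :=
  _root_.Literature.NumberTheory.LFunctions.Zhang2022.Section8eStatements.step8u022_holds (c' := c')

end Sequences

/-! ## `β₄ = β₁`, `β₅ = β₂` (p. 45) -/

section Shifts

variable (c' : ℝ) (D : ℕ)

/-- `Z22:§8.u023` OBJECT (p. 45, "Write `β₄ = β₁, β₅ = β₂`"; banked in `Skeleton.betaJ`, which reads
the index modulo `3`): `β₄ = β₁`. [cite: Zhang2022LandauSiegel, §8 p.45, tex L2330] -/
theorem betaJ_four : Skeleton.betaJ c' D 4 = Skeleton.beta1 c' D := by
  simp [Skeleton.betaJ]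

/-- `Z22:§8.u023` OBJECT: `β₅ = β₂`. [cite: Zhang2022LandauSiegel, §8 p.45, tex L2330] -/
theorem betaJ_five : Skeleton.betaJ c' D 5 = Skeleton.beta2 c' D := by
  simp [Skeleton.betaJ]

omit c' D in
/-- `Z22:§8.u024` CLAIM (p. 45, "so that"): "`{β_j, β_{j+1}, β_{j+2}} = {β₁, β₂, β₃}`" for
`1 ≤ j ≤ 3` (as sets). [cite: Zhang2022LandauSiegel, §8 p.45, tex L2334] -/
def Step8u024 : Prop :=
  ∀ (c' : ℝ) (D : ℕ) (j : ℕ), 1 ≤ j → j ≤ 3 →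
    ({Skeleton.betaJ c' D j, Skeleton.betaJ c' D (j + 1), Skeleton.betaJ c' D (j + 2)} : Set ℂ) =
      {Skeleton.beta1 c' D, Skeleton.beta2 c' D, Skeleton.beta3 c' D}

omit c' D in
/-- `Z22:§8.u024` holds (definitional: `Skeleton.betaJ` reads the index modulo `3`).
[cite: Zhang2022LandauSiegel, §8 p.45, tex L2334] -/
theorem step8u024_holds : Step8u024 := by
  intro c' D j hj1 hj3
  interval_cases j
  · simp [Skeleton.betaJ]
  · simp only [Skeleton.betaJ, Nat.reduceMod, Nat.reduceAdd]
    ext z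
    simp only [Set.mem_insert_iff, Set.mem_singleton_iff]
    tauto
  · simp only [Skeleton.betaJ, Nat.reduceMod, Nat.reduceAdd]
    ext z
    simp only [Set.mem_insert_iff, Set.mem_singleton_iff]
    tauto

/-- `Step8u024` — `_holds` alias of `step8u024_holds` above under the fact's exact name (appended
2026-08-28, D-0026 bookkeeping: the proof term is the existing theorem of this file; no statement,
definition or attribute is edited; no new named fact; the ledger's debt table listed the fact
unproved). [cite: Zhang2022LandauSiegel, §8 p.45, tex L2334] -/
theorem _root_.Literature.NumberTheory.LFunctions.Zhang2022.Section8eStatements.Step8u024_holds :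
    Step8u024 :=
  _root_.Literature.NumberTheory.LFunctions.Zhang2022.Section8eStatements.step8u024_holds

end Shifts

end Literature.NumberTheory.LFunctions.Zhang2022.Section8eStatements
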